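import Summits.AtomisticToContinuum.HydrodynamicLimit.Theorems.ImplosionDichotomyPolynomialCompressionShadowingDefs

/-!
# Objects of the shadowing estimate, levels 2–3 (line `log-lipschitz-budget`, crux `PolynomialCompression`)

Definitions file (reviewed) continuing `…ShadowingDefs.lean` for the proof of `stub_logBudgetShadowing`
of the crux `ImplosionDichotomy.PolynomialCompression` (stmt-AtomisticToContinuum-12587). The level-2 and
level-3 energy estimates bound the forcing `P_V(∂^α δV)` (tree: `…Level2Forcing.lean`, `…Level3Forcing.lean`)
POINTWISE through jet bounds (`…TorusJetCalculus/Identities/Bounds`), in the common shape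

`√(weight) · |forcing component| ≤ (Λ/(T₁ − t)) · TOP_k + Γ · ENV · (LOWER + σ³ (+ TOP₂² at level 3))`,

and this file only NAMES the pointwise magnitudes appearing there, so that the component bounds (several
files) and the level assemblies state literally the same quantities:
* `shadowTop2`, `shadowTop3` — the weighted magnitudes of ALL second (third) derivatives of `δV` at a point
  (their squares are dominated by a numerical multiple of the integrands of `shadowE2`, `shadowE3`);
* `shadowLow01` — the weighted magnitude of `δV` and of its first derivatives at a point (levels 0 and 1);
* `shadowEnv N K R c lam` — the generic polynomial envelope `((1 + lam⁻¹) R (1 + c + c⁻¹) (1 + K + K⁻¹))^N`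
  in the horizon distance `lam = T₁ − t`, a reference envelope `R ≥ 1`, the local density scale
  `c = ρ₁^{1/3}` and the adiabatic constant `K`; every lower-order coefficient is dominated by some `shadowEnv N`.
Only elementary order facts are proved (`shadowTop2_nonneg`, …, `one_le_shadowEnv`, `shadowEnv_mono`).
-/

noncomputable section

namespace Summit.AtomisticToContinuum.HydrodynamicLimit.Theorems

open Set MeasureTheory
open Literature.MathematicalPhysics.KineticTheory Literature.Analysis.FunctionSpaces

/-- Weighted pointwise magnitude of all second derivatives of `δV = (ρ − ρ₁, u − u₁, θ − θ₁)` at `(s, x)`: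
`Σᵢ Σₗ (√A |∂ᵢ∂ₗδρ| + √ρ ‖∂ᵢ∂ₗδu‖ + √B |∂ᵢ∂ₗδθ|)` (same index conventions as `shadowE2`). [folklore] -/
def shadowTop2 (ζ : ℝ → ℝ) (ρ θ : ℝ → T3 → ℝ) (u : ℝ → T3 → V3) (ρ₁ θ₁ : ℝ → T3 → ℝ)
    (u₁ : ℝ → T3 → V3) (s : ℝ) (x : T3) : ℝ :=
  ∑ i : Fin 3, ∑ l : Fin 3,
    (Real.sqrt (shadowWeightA ζ ρ θ s x) *
        |Torus.partialDeriv i (Torus.partialDeriv l (fun y => ρ s y - ρ₁ s y)) x| +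
      Real.sqrt (ρ s x) * ‖Torus.partialDeriv i (Torus.partialDeriv l (fun y => u s y - u₁ s y)) x‖ +
      Real.sqrt (shadowWeightB ρ θ s x) *
        |Torus.partialDeriv i (Torus.partialDeriv l (fun y => θ s y - θ₁ s y)) x|)

/-- Weighted pointwise magnitude of all third derivatives of `δV` at `(s, x)`:
`Σⱼ Σᵢ Σₗ (√A |∂ⱼ∂ᵢ∂ₗδρ| + √ρ ‖∂ⱼ∂ᵢ∂ₗδu‖ + √B |∂ⱼ∂ᵢ∂ₗδθ|)` (same index conventions as `shadowE3`).
[folklore] -/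
def shadowTop3 (ζ : ℝ → ℝ) (ρ θ : ℝ → T3 → ℝ) (u : ℝ → T3 → V3) (ρ₁ θ₁ : ℝ → T3 → ℝ)
    (u₁ : ℝ → T3 → V3) (s : ℝ) (x : T3) : ℝ :=
  ∑ j : Fin 3, ∑ i : Fin 3, ∑ l : Fin 3,
    (Real.sqrt (shadowWeightA ζ ρ θ s x) *
        |Torus.partialDeriv j (Torus.partialDeriv i (Torus.partialDeriv l (fun y => ρ s y - ρ₁ s y))) x| +
      Real.sqrt (ρ s x) *
        ‖Torus.partialDeriv j (Torus.partialDeriv i (Torus.partialDeriv l (fun y => u s y - u₁ s y))) x‖ +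
      Real.sqrt (shadowWeightB ρ θ s x) *
        |Torus.partialDeriv j (Torus.partialDeriv i (Torus.partialDeriv l (fun y => θ s y - θ₁ s y))) x|)

/-- Weighted pointwise magnitude of `δV` and of its first derivatives at `(s, x)` (levels 0 and 1):
`√A|δρ| + √ρ‖δu‖ + √B|δθ| + Σₗ (√A |∂ₗδρ| + √ρ ‖∂ₗδu‖ + √B |∂ₗδθ|)`. [folklore] -/
def shadowLow01 (ζ : ℝ → ℝ) (ρ θ : ℝ → T3 → ℝ) (u : ℝ → T3 → V3) (ρ₁ θ₁ : ℝ → T3 → ℝ)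
    (u₁ : ℝ → T3 → V3) (s : ℝ) (x : T3) : ℝ :=
  Real.sqrt (shadowWeightA ζ ρ θ s x) * |ρ s x - ρ₁ s x| + Real.sqrt (ρ s x) * ‖u s x - u₁ s x‖ +
      Real.sqrt (shadowWeightB ρ θ s x) * |θ s x - θ₁ s x| +
    ∑ l : Fin 3,
      (Real.sqrt (shadowWeightA ζ ρ θ s x) * |Torus.partialDeriv l (fun y => ρ s y - ρ₁ s y) x| +
        Real.sqrt (ρ s x) * ‖Torus.partialDeriv l (fun y => u s y - u₁ s y) x‖ +
        Real.sqrt (shadowWeightB ρ θ s x) * |Torus.partialDeriv l (fun y => θ s y - θ₁ s y) x|)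

/-- The generic polynomial envelope of the lower-order coefficients:
`shadowEnv N K R c lam = ((1 + lam⁻¹) · R · (1 + c + c⁻¹) · (1 + K + K⁻¹)) ^ N`, used with `lam = T₁ − t`,
`R ≥ 1` a reference envelope (`shadow_reference_envelope`), `c = ρ₁(t,x)^{1/3}`, `K` the adiabatic
constant. [folklore] -/
def shadowEnv (N : ℕ) (K R c lam : ℝ) : ℝ :=
  ((1 + lam⁻¹) * R * (1 + c + c⁻¹) * (1 + K + K⁻¹)) ^ N

/-- `shadowTop2` is nonnegative. [folklore] -/
theorem shadowTop2_nonneg :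
    ∀ {ζ : ℝ → ℝ} {ρ θ ρ₁ θ₁ : ℝ → T3 → ℝ} {u u₁ : ℝ → T3 → V3} {s : ℝ} {x : T3},
      0 ≤ shadowTop2 ζ ρ θ u ρ₁ θ₁ u₁ s x := by
  intro ζ ρ θ ρ₁ θ₁ u u₁ s x
  unfold shadowTop2
  positivity

/-- `shadowTop3` is nonnegative. [folklore] -/
theorem shadowTop3_nonneg :
    ∀ {ζ : ℝ → ℝ} {ρ θ ρ₁ θ₁ : ℝ → T3 → ℝ} {u u₁ : ℝ → T3 → V3} {s : ℝ} {x : T3},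
      0 ≤ shadowTop3 ζ ρ θ u ρ₁ θ₁ u₁ s x := by
  intro ζ ρ θ ρ₁ θ₁ u u₁ s x
  unfold shadowTop3
  positivity

/-- `shadowLow01` is nonnegative. [folklore] -/
theorem shadowLow01_nonneg :
    ∀ {ζ : ℝ → ℝ} {ρ θ ρ₁ θ₁ : ℝ → T3 → ℝ} {u u₁ : ℝ → T3 → V3} {s : ℝ} {x : T3},
      0 ≤ shadowLow01 ζ ρ θ u ρ₁ θ₁ u₁ s x := by
  intro ζ ρ θ ρ₁ θ₁ u u₁ s x
  unfold shadowLow01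
  positivity

/-- The base of the envelope is at least `1` when `lam > 0`, `R ≥ 1`, `c > 0`, `K > 0`. [folklore] -/
theorem one_le_shadowEnv_base {K R c lam : ℝ} (hK : 0 < K) (hR : 1 ≤ R) (hc : 0 < c) (hlam : 0 < lam) :
    1 ≤ (1 + lam⁻¹) * R * (1 + c + c⁻¹) * (1 + K + K⁻¹) := by
  have h1 : (1 : ℝ) ≤ 1 + lam⁻¹ := le_add_of_nonneg_right (inv_nonneg.mpr hlam.le)
  have h2 : (1 : ℝ) ≤ 1 + c + c⁻¹ := by
    have := inv_nonneg.mpr hc.le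
    linarith [hc.le]
  have h3 : (1 : ℝ) ≤ 1 + K + K⁻¹ := by
    have := inv_nonneg.mpr hK.le
    linarith [hK.le]
  calc (1 : ℝ) = 1 * 1 * 1 * 1 := by ring
    _ ≤ (1 + lam⁻¹) * R * (1 + c + c⁻¹) * (1 + K + K⁻¹) := by
      gcongr

/-- `1 ≤ shadowEnv N K R c lam` when `lam > 0`, `R ≥ 1`, `c > 0`, `K > 0`. [folklore] -/
theorem one_le_shadowEnv :
    ∀ (N : ℕ) {K R c lam : ℝ}, 0 < K → 1 ≤ R → 0 < c → 0 < lam → 1 ≤ shadowEnv N K R c lam := by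
  intro N K R c lam hK hR hc hlam
  unfold shadowEnv
  exact one_le_pow₀ (one_le_shadowEnv_base hK hR hc hlam)

/-- Monotonicity of the envelope in the exponent: `shadowEnv N ≤ shadowEnv N'` for `N ≤ N'`
(base `≥ 1`). [folklore] -/
theorem shadowEnv_mono :
    ∀ {N N' : ℕ} {K R c lam : ℝ}, 0 < K → 1 ≤ R → 0 < c → 0 < lam → N ≤ N' →
      shadowEnv N K R c lam ≤ shadowEnv N' K R c lam := by
  intro N N' K R c lam hK hR hc hlam hN
  unfold shadowEnv
  exact pow_le_pow_right₀ (one_le_shadowEnv_base hK hR hc hlam) hN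

/-- Submultiplicativity in the exponent: `shadowEnv N * shadowEnv N' = shadowEnv (N + N')`. [folklore] -/
theorem shadowEnv_mul (N N' : ℕ) (K R c lam : ℝ) :
    shadowEnv N K R c lam * shadowEnv N' K R c lam = shadowEnv (N + N') K R c lam := by
  unfold shadowEnv
  rw [pow_add]

/-- Monotonicity of the envelope in `R`: for `1 ≤ R ≤ R'` (other parameters positive). [folklore] -/
theorem shadowEnv_mono_R :
    ∀ (N : ℕ) {K R R' c lam : ℝ}, 0 < K → 1 ≤ R → R ≤ R' → 0 < c → 0 < lam →
      shadowEnv N K R c lam ≤ shadowEnv N K R' c lam := by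
  intro N K R R' c lam hK hR hRR' hc hlam
  unfold shadowEnv
  have hb : 0 ≤ (1 + lam⁻¹) * R * (1 + c + c⁻¹) * (1 + K + K⁻¹) :=
    zero_le_one.trans (one_le_shadowEnv_base hK hR hc hlam)
  apply pow_le_pow_left₀ hb
  have h1 : (0 : ℝ) ≤ 1 + lam⁻¹ := by positivity
  have h2 : (0 : ℝ) ≤ 1 + c + c⁻¹ := by positivity
  have h3 : (0 : ℝ) ≤ 1 + K + K⁻¹ := by positivity
  gcongr

end Summit.AtomisticToContinuum.HydrodynamicLimit.Theorems

end
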